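import Summits.Ventures.PercRepro.RankLevelSetLevelNineArithQuartZA
import Summits.Ventures.PercRepro.RankLevelSetLevelNineArithQuartZB
import Summits.Ventures.PercRepro.RankLevelSetLevelNineArithQuartZC
import Summits.Ventures.PercRepro.RankLevelSetLevelNineArithQuartZD

/-!
# PercRepro — THE LEVEL-`9` DISPATCHER OF THE QUARTIC PARTITION CHAIN AT BASE `291`: the per-corank form `(c₁, c₂)`, `(P_d)` and
the `Y`-tail for `10 ≤ d ≤ 333` (p2, gen 34; a feeder for S4 — the top of the `q = 9` window). The four quarters ZA … ZD.
Axioms: standard.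
-/

set_option exponentiation.threshold 1024

namespace PercRepro

namespace ThmN

/-- **THE PER-CORANK FORM OF THE QUARTIC LEVEL-`9` CHAIN AT BASE `291`**: for every corank `10 ≤ d ≤ 333`, every `p ≥ 291` and every
`n ≥ 291 + d` there are `0 < c₂ < c₁` with the certificate `c₁·U_b ≤ c₂·2^{d−9}·C(p+9, 9)` and the tail `c₁·G₉(d, n) ≤ (c₁ − c₂)·2^n`. -/
theorem quart_form_nine (d : ℕ) (hd1 : 10 ≤ d) (hd2 : d ≤ 333) (p : ℕ) (hp : 291 ≤ p) (n : ℕ) (hn : 291 + d ≤ n) :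
    ∃ c₁ c₂ : ℕ, 0 < c₂ ∧ c₂ < c₁ ∧
    ((c₁ : ℕ) : ℚ) * ((((p + d).choose 9 : ℕ) : ℚ) + (∑ j ∈ Finset.range (d - 9), ((Nat.choose (min 309 (max ((d + min 151 d) / 2 + 1) (min 150 (d - 1) + 2) - 2)) j : ℕ) : ℚ) / (((j + 1) + 3 * (j + 1).choose 2 + 3 * (j + 1).choose 3 + 2 * (j + 1).choose 4 : ℕ) : ℚ)) *
      (((d * (d + 1) / 2 : ℕ) : ℚ) * ((p + d).choose 7 : ℚ) + ((d * (d + 1) * (d + 2) / 3 : ℕ) : ℚ) * ((p + d).choose 6 : ℚ) + (((d + 4).choose 5 : ℕ) : ℚ) * ((p + d).choose 5 : ℚ) + (((d + 5).choose 6 : ℕ) : ℚ) * ((p + d).choose 4 : ℚ) + (((d + 6).choose 7 : ℕ) : ℚ) * ((p + d).choose 3 : ℚ) + (((d + 7).choose 8 : ℕ) : ℚ) * ((p + d).choose 2 : ℚ) + (((d + 8).choose 9 : ℕ) : ℚ) * (p + d : ℚ) + (((d + 9).choose 10 : ℕ) : ℚ)) +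
      ((∑ j ∈ Finset.range (d - 9), ((Nat.choose (min 319 (9 + d) - 10) j : ℕ) : ℚ) / (((j + 1) + 3 * (j + 1).choose 2 + 3 * (j + 1).choose 3 + 2 * (j + 1).choose 4 : ℕ) : ℚ)) - (∑ j ∈ Finset.range (d - 9), ((Nat.choose (min 150 (d - 1)) j : ℕ) : ℚ) / (((j + 1) + 3 * (j + 1).choose 2 + 3 * (j + 1).choose 3 + 2 * (j + 1).choose 4 : ℕ) : ℚ))) *
      ((d * (d + 1) / 2 * (min 319 (9 + d)).choose 7 + d * (d + 1) * (d + 2) / 3 * (min 319 (9 + d)).choose 6 + (d + 4).choose 5 * (min 319 (9 + d)).choose 5 + (d + 5).choose 6 * (min 319 (9 + d)).choose 4 + (d + 6).choose 7 * (min 319 (9 + d)).choose 3 + (d + 7).choose 8 * (min 319 (9 + d)).choose 2 + (d + 8).choose 9 * (min 319 (9 + d)) + (d + 9).choose 10 : ℕ) : ℚ)) ≤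
      ((c₂ : ℕ) : ℚ) * 2 ^ (d - 9) * (((p + 9).choose 9 : ℕ) : ℚ) ∧
      c₁ * (n.choose 9 * 2 ^ (min 310 d) + n.choose 8 * 2 ^ 151 + n.choose 7 * 2 ^ 72 + n.choose 6 * 2 ^ 33 + n.choose 5 * 2 ^ 14 + n.choose 4 * 2 ^ 6 + n.choose 3 * 2 ^ 3 + n.choose 2 * 2 + n + 1 + ∑ j ∈ Finset.range (d + 1), n.choose j) ≤ (c₁ - c₂) * 2 ^ n := by
  rcases Nat.lt_or_ge d (90 + 1) with h | h
  · exact quart_form_nine_ZA d hd1 (by omega) p hp n hn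
  rcases Nat.lt_or_ge d (171 + 1) with h' | h'
  · exact quart_form_nine_ZB d (by omega) (by omega) p hp n hn
  rcases Nat.lt_or_ge d (252 + 1) with h'' | h''
  · exact quart_form_nine_ZC d (by omega) (by omega) p hp n hn
  · exact quart_form_nine_ZD d (by omega) hd2 p hp n hn

end ThmN

end PercRepro
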